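import Summits.Ventures.Crystal3D.Theorems.StickyWulffConstantCoaxialWallLawPayerCell
import Summits.Ventures.Crystal3D.Theorems.StickyWulffConstantCoaxialWallLawInPlaneSlotSharp
import Summits.Ventures.Crystal3D.Theorems.StickyWulffConstantCoaxialWallLawTerracePropagation
import Summits.Ventures.Crystal3D.Theorems.StickyWulffConstantCoaxialWallLawInteriorLedger
import Summits.Ventures.Crystal3D.Theorems.StickyWulffConstantCoaxialWallLawHaggConst
import Summits.Ventures.Crystal3D.Theorems.StickyWulffConstantGenericWallFloorCoaxialIff
import Summits.Ventures.Crystal3D.Theorems.StickyWulffConstantGenericWallFloorSampleDeficitUpper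
import Summits.Ventures.Crystal3D.Theorems.StickyWulffConstantGenericWallFloorRigidRung
import Summits.Ventures.Crystal3D.Theorems.StickyWulffConstantNoReconstructionGainLatticeAdhesion
import HarnessLib

/-!
# End accounting for the word automaton, census-free IV: the twin law with constant √6/312 (KissingGap + KissingClassification only)

HONEST FRAMING. Part of the venture `Summits/Ventures/Crystal3D` (cell `crystal3d-full`), helper for the crux
`CoaxialWallLaw` (stmt-Ventures-19481) of `route-Ventures-StickyWulffConstant`, REGISTERED line `WallLedgerF`
(planner cf-p1), open stub `stub_coaxialTwoSlabAdhesion` (general fillings).  Rung credit only; F-C1 not moved.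

WHY THIS FILE.  `…ExactTwin.coaxialTwoSlabAdhesion_general_twin_exact` (constant `√6/88`) and every sharper rung of
line `WallLedgerF` for twins (`…SharpTwin`, `…KFoldTopSplit`: `½`) carry the E1 row A12-583 (`hcertA`, the GLIDE
STAR) — REFUTED by an exact witness (`…GenericWallFloorGlideStarWitness.not_exactOnly_glideStar583`, lit g13) — and
the sharp ones also the census Prop `KFoldTopDeficit`, refuted at glide arrivals (lit g13, KFOLD-CENSUS).  They are
conditional on false hypotheses.  This file is the CENSUS-FREE twin law (planner cf-p1's option (A), INBOX
2026-08-28T04:19:27Z): the inequality of `stub_coaxialTwoSlabAdhesion` for EVERY twin pair (`A₁·Λ₀ ≠ A₂·Λ₀`) and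
ARBITRARY unit-separated fillings, with the crux's constant `½` replaced by `√6/312 ≈ 7.85·10⁻³`, modulo ONLY the
kissing facts `KissingGap δ`, `KissingClassification δ` BY NAME (the inputs of 19481-p2's `coaxialWallLaw_smallCharge`,
constant `√2/11440 ≈ 1.24·10⁻⁴`, which this improves ×63 on twin pairs):

  `cross(P₁, X∖P₁) + cross(P₂, Y) ≤ D(Y) + (φ₁ + φ₂ − (√6/312)·√(1 − ⟪L e₃, e₃⟫²)) π ρ² + C (1 + h) ρ`.

Chain: in-plane-rooted word automaton (`…ExactCount`, no census) → every reachable END is unsaturated or has two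
unsaturated contact neighbours (`…EndDichotomy`, dozen step) → `sources ≤ 78·#unsaturated + rims`
(`…PayerInstance`) → cell (`…PayerCell`) → this assembly (verbatim `…ExactTwin`'s with `22 ↦ 78`).  The `78 = 12 + 66`
is crude (trivial sharing bound `11·12/2` for saturated ends); the flux `(√6/2)·sin θ` of the sharp in-plane slot is
exact.

WHAT THIS IS NOT: not the stub (constant `√6/312 < ½`); translation pairs are 19481-p2's lane; F-C1 not moved.
-/
noncomputable section

namespace Summit.Ventures.Crystal3D.Theorems

open Summit.Ventures.Crystal3D Finset
open Literature.MathematicalPhysics.StatisticalMechanics (fccStacking barlowStacking IsHaggSeq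
  contactDeficiency)
open scoped InnerProductSpace

open scoped Classical in
/-- **The CENSUS-FREE in-plane rung of `stub_coaxialTwoSlabAdhesion` (general fillings, all twin pairs, no residual,
constant `√6/312`; `KissingGap δ`, `KissingClassification δ` BY NAME).**  See the module docstring. -/
theorem coaxialTwoSlabAdhesion_general_twin_censusFree {δ : ℝ} (hg : KissingGap δ) (hc : KissingClassification δ)
    (A₁ : EuclideanSpace ℝ (Fin 3) ≃ₗᵢ[ℝ] EuclideanSpace ℝ (Fin 3)) (t₁ : EuclideanSpace ℝ (Fin 3))
    (A₂ : EuclideanSpace ℝ (Fin 3) ≃ₗᵢ[ℝ] EuclideanSpace ℝ (Fin 3)) (t₂ : EuclideanSpace ℝ (Fin 3))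
    (L : EuclideanSpace ℝ (Fin 3) ≃ₗᵢ[ℝ] EuclideanSpace ℝ (Fin 3)) (s₁ s₂ : EuclideanSpace ℝ (Fin 3))
    (σ σ' : ℤ → ℤ) (hσ : IsHaggSeq σ) (hσ' : IsHaggSeq σ')
    (hsub₁ : (fun p => A₁ p + t₁) '' fccStacking 1 (Real.sqrt (2 / 3)) ⊆
      (fun p => L p + s₁) '' barlowStacking 1 (Real.sqrt (2 / 3)) σ)
    (hsub₂ : (fun p => A₂ p + t₂) '' fccStacking 1 (Real.sqrt (2 / 3)) ⊆
      (fun p => L p + s₂) '' barlowStacking 1 (Real.sqrt (2 / 3)) σ')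
    (htwin : A₁ '' fccStacking 1 (Real.sqrt (2 / 3)) ≠ A₂ '' fccStacking 1 (Real.sqrt (2 / 3))) :
    ∃ C R₀ : ℝ, 1 ≤ R₀ ∧ ∀ h : ℝ, 0 ≤ h → ∀ ρ : ℝ, R₀ ≤ ρ →
      ∀ X P₁ P₂ : Finset (EuclideanSpace ℝ (Fin 3)),
      (∀ p ∈ X, ∀ q ∈ X, p ≠ q → 1 ≤ dist p q) → P₁ ⊆ X → P₂ ⊆ X \ P₁ →
      (∀ p ∈ X, -(2 * R₀) ≤ p 2 ∧ p 2 ≤ h + 2 * R₀ ∧ p 0 ^ 2 + p 1 ^ 2 ≤ ρ ^ 2) →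
      (∀ p, p ∈ P₁ ↔ (p ∈ (fun q => A₁ q + t₁) '' fccStacking 1 (Real.sqrt (2 / 3)) ∧
        -(2 * R₀) ≤ p 2 ∧ p 2 ≤ -R₀ ∧ p 0 ^ 2 + p 1 ^ 2 ≤ ρ ^ 2)) →
      (∀ p, p ∈ P₂ ↔ (p ∈ (fun q => A₂ q + t₂) '' fccStacking 1 (Real.sqrt (2 / 3)) ∧
        h + R₀ ≤ p 2 ∧ p 2 ≤ h + 2 * R₀ ∧ p 0 ^ 2 + p 1 ^ 2 ≤ ρ ^ 2)) →
      ((((P₁ ×ˢ (X \ P₁)).filter fun pq => dist pq.1 pq.2 = 1).card : ℕ) : ℝ) +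
        ((((P₂ ×ˢ ((X \ P₁) \ P₂)).filter fun pq => dist pq.1 pq.2 = 1).card : ℕ) : ℝ) ≤
        contactDeficiency ((X \ P₁) \ P₂) +
          (Real.sqrt 2 / 4 * ∑ᶠ w ∈ {w ∈ fccStacking 1 (Real.sqrt (2 / 3)) | ‖w‖ = 1},
              |⟪w, A₁.symm (EuclideanSpace.single (2 : Fin 3) (1 : ℝ))⟫_ℝ| +
            Real.sqrt 2 / 4 * ∑ᶠ w ∈ {w ∈ fccStacking 1 (Real.sqrt (2 / 3)) | ‖w‖ = 1},
              |⟪w, A₂.symm (EuclideanSpace.single (2 : Fin 3) (1 : ℝ))⟫_ℝ| -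
            (Real.sqrt 6 / 312 : ℝ) * Real.sqrt (1 - ⟪L (EuclideanSpace.single (2 : Fin 3) (1 : ℝ)),
              (EuclideanSpace.single (2 : Fin 3) (1 : ℝ))⟫_ℝ ^ 2)) * Real.pi * ρ ^ 2 +
          C * (1 + h) * ρ := by
  set e₃ : EuclideanSpace ℝ (Fin 3) := EuclideanSpace.single (2 : Fin 3) (1 : ℝ) with he₃
  set RL : EuclideanSpace ℝ (Fin 3) ≃ₗᵢ[ℝ] EuclideanSpace ℝ (Fin 3) :=
    (ℝ ∙ EuclideanSpace.single (2 : Fin 3) (1 : ℝ)).reflection.trans L with hRL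
  have hr : 0 < Real.sqrt (2 / 3) := Real.sqrt_pos.2 (by norm_num)
  have he₃1 : ‖e₃‖ = 1 := by rw [he₃, PiLp.norm_single, norm_one]
  obtain ⟨C₁, hC₁⟩ := affineSampleDeficit_upper A₁ t₁ 10 (by norm_num)
  obtain ⟨C₂, hC₂⟩ := affineSampleDeficit_upper A₂ t₂ 10 (by norm_num)
  -- the pair is a twin pair in the frame: `σ 0 ≠ σ' 0`
  have htw : σ 0 ≠ σ' 0 := by
    intro heq
    obtain ⟨-, e₁⟩ := linear_image_eq_frame_of_subset A₁ L t₁ s₁ hσ hsub₁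
    obtain ⟨-, e₂⟩ := linear_image_eq_frame_of_subset A₂ L t₂ s₂ hσ' hsub₂
    exact htwin (by rw [e₁, e₂, heq])
  -- normal form: the grains are `F false·Λ₀ + s₁`, `F true·Λ₀ + s₂` with `{F false, F true} = {L, L∘R}`
  have hnorm : ∃ F : Bool → (EuclideanSpace ℝ (Fin 3) ≃ₗᵢ[ℝ] EuclideanSpace ℝ (Fin 3)),
      ((F false = L ∧ F true = RL) ∨ (F false = RL ∧ F true = L)) ∧
      (fun q => A₁ q + t₁) '' fccStacking 1 (Real.sqrt (2 / 3)) =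
        (fun q => F false q + s₁) '' fccStacking 1 (Real.sqrt (2 / 3)) ∧
      (fun q => A₂ q + t₂) '' fccStacking 1 (Real.sqrt (2 / 3)) =
        (fun q => F true q + s₂) '' fccStacking 1 (Real.sqrt (2 / 3)) := by
    rcases hσ 0 with h1 | hm1
    · have hm1' : σ' 0 = -1 := (hσ' 0).resolve_left fun h' => htw (h1.trans h'.symm)
      have e₁ := coaxial_frame_eq_fcc_of_one A₁ t₁ L s₁ hσ hsub₁ h1
      obtain ⟨e₂, -⟩ := coaxial_frame_eq_fcc_of_neg_one A₂ t₂ L s₂ hσ' hsub₂ hm1'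
      exact ⟨fun c => cond c RL L, Or.inl ⟨rfl, rfl⟩, e₁, e₂⟩
    · have h1' : σ' 0 = 1 := (hσ' 0).resolve_right fun h' => htw (hm1.trans h'.symm)
      obtain ⟨e₁, -⟩ := coaxial_frame_eq_fcc_of_neg_one A₁ t₁ L s₁ hσ hsub₁ hm1
      have e₂ := coaxial_frame_eq_fcc_of_one A₂ t₂ L s₂ hσ' hsub₂ h1'
      exact ⟨fun c => cond c L RL, Or.inr ⟨rfl, rfl⟩, e₁, e₂⟩
  obtain ⟨F, hF, e₁, e₂⟩ := hnorm
  -- the axis `n = L e₃`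
  obtain ⟨n, hn⟩ : ∃ n : EuclideanSpace ℝ (Fin 3), n = L e₃ ∨ n = -L e₃ := ⟨L e₃, Or.inl rfl⟩
  -- the sharp in-plane slot of the bottom frame
  have hsubF : (fun p => F false p + s₁) '' fccStacking 1 (Real.sqrt (2 / 3)) ⊆
      (fun p => L p + s₁) '' barlowStacking 1 (Real.sqrt (2 / 3)) σ := by rw [← e₁]; exact hsub₁
  obtain ⟨u, huS, hu0, huup, hflux⟩ := exists_inPlane_slot_of_coaxial_sharp (F false) s₁ L s₁ hσ hsubF
  have hun : ⟪F false u, n⟫_ℝ = 0 := by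
    rcases hn with h' | h'
    · rw [h']; exact hu0
    · rw [h', inner_neg_right, hu0, neg_zero]
  have h2a : (F false u) 2 = ⟪F false u, e₃⟫_ℝ := apply_two_eq_inner_e₃ _
  set s : ℝ := Real.sqrt (1 - ⟪L e₃, e₃⟫_ℝ ^ 2) with hs
  have hs0 : 0 ≤ s := Real.sqrt_nonneg _
  -- the flux of the in-plane slot beats `(√6/2) sin θ`
  have h63 : Real.sqrt 6 / 2 * s ≤ Real.sqrt 2 * (F false u) 2 := by
    rw [h2a, ← abs_of_nonneg huup]; linarith only [hflux]
  -- the constant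
  have hCE0 : (0 : ℝ) ≤ 12 * Real.sqrt 2 * Real.pi + 36 * 10 + 55440 := by positivity
  refine ⟨|C₁| + |C₂| + (240 * Real.sqrt 2 * Real.pi + 3120 * (4 * 10 + 2)) / 2 +
    (12 * Real.sqrt 2 * Real.pi + 36 * 10 + 55440) / 156, 10, by norm_num, ?_⟩
  intro h hh ρ hρ X P₁ P₂ hX hP₁X hP₂X₁ hcyl hP₁ hP₂
  set φ₁ : ℝ := Real.sqrt 2 / 4 * ∑ᶠ w ∈ {w ∈ fccStacking 1 (Real.sqrt (2 / 3)) | ‖w‖ = 1},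
      |⟪w, A₁.symm e₃⟫_ℝ| with hφ₁
  set φ₂ : ℝ := Real.sqrt 2 / 4 * ∑ᶠ w ∈ {w ∈ fccStacking 1 (Real.sqrt (2 / 3)) | ‖w‖ = 1},
      |⟪w, A₂.symm e₃⟫_ℝ| with hφ₂
  have hP₂X : P₂ ⊆ X := hP₂X₁.trans sdiff_subset
  have hρ0 : (0 : ℝ) ≤ ρ := by linarith
  -- (1) the two slab samples from above
  have hD₁ := hC₁ (-(2 * 10)) (-10) (by norm_num) ρ hρ P₁ hP₁
  have hD₂ := hC₂ (h + 10) (h + 2 * 10) (by ring) ρ hρ P₂ hP₂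
  -- (2) the interior ledger
  have hled := ledger_ge_faces_add_interior A₁ t₁ A₂ t₂ X P₁ P₂ 10 h ρ le_rfl hh hρ hX hcyl hP₁X hP₂X
    hP₁ hP₂
  have hf₁ : Real.sqrt 2 / 4 * ∑ w ∈ fccSlots, |⟪A₁ w, e₃⟫_ℝ| = φ₁ := by
    rw [hφ₁, finsum_unit_fcc_symm_eq_sum_slots]
  have hf₂ : Real.sqrt 2 / 4 * ∑ w ∈ fccSlots, |⟪A₂ w, e₃⟫_ℝ| = φ₂ := by
    rw [hφ₂, finsum_unit_fcc_symm_eq_sum_slots]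
  rw [hf₁, hf₂, ← two_mul_contactDeficiency_eq_sum X] at hled
  -- (3) the payers of the interior window, fed by the in-plane lines (if they rise)
  have hP₁' := hP₁
  have hP₂' := hP₂
  simp only [e₁, e₂] at hP₁' hP₂'
  have hpay : Real.sqrt 6 / 2 * s * Real.pi * ρ ^ 2 - (12 * Real.sqrt 2 * Real.pi + 36 * 10 + 55440) * ρ ≤
      78 * ((X.filter fun z => (X.filter fun q => dist z q = 1).card ≤ 11 ∧
        -10 - 2 ≤ z 2 ∧ z 2 ≤ h + 10 + 2).card : ℝ) := by
    by_cases hα : 0 < (F false u) 2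
    · have hcellpay := wordNet_twin_payers_ge_censusFree hg hc L F hF hn huS hun hα s₁ s₂ X P₁ P₂ 10 h ρ
        le_rfl hh hρ hX hcyl hP₁X hP₂X hP₁' hP₂'
      have hπρ : 0 ≤ Real.pi * ρ ^ 2 := by positivity
      have hflux' : Real.sqrt 6 / 2 * s * Real.pi * ρ ^ 2 ≤ Real.sqrt 2 * (F false u) 2 * Real.pi * ρ ^ 2 := by
        have := mul_le_mul_of_nonneg_right h63 hπρ
        simp only [mul_assoc] at this ⊢
        exact this
      refine le_trans ?_ hcellpay
      linarith only [hflux']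
    · -- the in-plane slot is horizontal: `sin θ = 0`
      push Not at hα
      have hα0 : (F false u) 2 = 0 := le_antisymm hα (by rw [h2a]; exact huup)
      have hs00 : s = 0 := by
        have h6 : 0 < Real.sqrt 6 / 2 := by positivity
        have : Real.sqrt 6 / 2 * s ≤ 0 := by rw [hα0, mul_zero] at h63; exact h63
        nlinarith only [this, h6, hs0]
      rw [hs00, mul_zero, zero_mul, zero_mul, zero_sub]
      have h1 : 0 ≤ (12 * Real.sqrt 2 * Real.pi + 36 * 10 + 55440) * ρ := mul_nonneg hCE0 hρ0
      have h2 : (0 : ℝ) ≤ 78 * ((X.filter fun z => (X.filter fun q => dist z q = 1).card ≤ 11 ∧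
          -10 - 2 ≤ z 2 ∧ z 2 ≤ h + 10 + 2).card : ℝ) := by positivity
      linarith only [h1, h2]
  have hPAY : ((X.filter fun z => (X.filter fun q => dist z q = 1).card ≤ 11 ∧
        -10 - 2 ≤ z 2 ∧ z 2 ≤ h + 10 + 2).card : ℝ) ≤
      ((X.filter fun y => (X.filter fun q => dist y q = 1).card ≠ 12 ∧
        -10 - 2 ≤ y 2 ∧ y 2 ≤ h + 10 + 2).card : ℝ) := by
    exact_mod_cast card_le_card fun z hz => by
      rw [mem_filter] at hz ⊢
      exact ⟨hz.1, by have := hz.2.1; omega, hz.2.2⟩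
  -- (5) the two splits of the skeleton
  have hs₁ := contactDeficiency_sdiff_split hP₁X
  have hs₂ := contactDeficiency_sdiff_split hP₂X₁
  -- (6) assemble
  have ha : C₁ * ρ ≤ |C₁| * (1 + h) * ρ := by
    have h1 : C₁ * ρ ≤ |C₁| * ρ := mul_le_mul_of_nonneg_right (le_abs_self _) hρ0
    have h2 : 0 ≤ |C₁| * h * ρ := by positivity
    linarith only [h1, h2]
  have hb : C₂ * ρ ≤ |C₂| * (1 + h) * ρ := by
    have h1 : C₂ * ρ ≤ |C₂| * ρ := mul_le_mul_of_nonneg_right (le_abs_self _) hρ0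
    have h2 : 0 ≤ |C₂| * h * ρ := by positivity
    linarith only [h1, h2]
  have hCE : (12 * Real.sqrt 2 * Real.pi + 36 * 10 + 55440) * ρ ≤
      (12 * Real.sqrt 2 * Real.pi + 36 * 10 + 55440) * (1 + h) * ρ := by
    have := mul_nonneg (mul_nonneg hCE0 hh) hρ0
    linarith only [this]
  -- name the four counts
  set PAY : Finset (EuclideanSpace ℝ (Fin 3)) := X.filter fun z => (X.filter fun q => dist z q = 1).card ≤ 11 ∧
    -10 - 2 ≤ z 2 ∧ z 2 ≤ h + 10 + 2
  set PAY' : Finset (EuclideanSpace ℝ (Fin 3)) := X.filter fun y => (X.filter fun q => dist y q = 1).card ≠ 12 ∧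
    -10 - 2 ≤ y 2 ∧ y 2 ≤ h + 10 + 2
  have t1 : ((((P₁ ×ˢ (X \ P₁)).filter fun pq => dist pq.1 pq.2 = 1).card : ℕ) : ℝ) +
      ((((P₂ ×ˢ ((X \ P₁) \ P₂)).filter fun pq => dist pq.1 pq.2 = 1).card : ℕ) : ℝ) =
      contactDeficiency P₁ + contactDeficiency P₂ + contactDeficiency ((X \ P₁) \ P₂) -
        contactDeficiency X := by linarith only [hs₁, hs₂]
  have t2 : Real.sqrt 6 / 2 * s * Real.pi * ρ ^ 2 - (12 * Real.sqrt 2 * Real.pi + 36 * 10 + 55440) * ρ ≤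
      78 * (PAY'.card : ℝ) := by
    linarith only [hpay, hPAY]
  have t3 : 2 * φ₁ * Real.pi * ρ ^ 2 + 2 * φ₂ * Real.pi * ρ ^ 2 + (PAY'.card : ℝ) -
      (240 * Real.sqrt 2 * Real.pi + 3120 * (4 * 10 + 2)) * (1 + h) * ρ ≤ 2 * contactDeficiency X := by
    linarith only [hled]
  have t4 : contactDeficiency P₁ ≤ 2 * φ₁ * Real.pi * ρ ^ 2 + C₁ * ρ := hD₁
  have t5 : contactDeficiency P₂ ≤ 2 * φ₂ * Real.pi * ρ ^ 2 + C₂ * ρ := hD₂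
  linarith only [t1, t2, t3, t4, t5, ha, hb, hCE]

end Summit.Ventures.Crystal3D.Theorems

end
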